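import Summits.AtomisticToContinuum.FouriersLaw.Theorems.BondHeatUncertaintyExtensiveSnapshotIrreversibilityEnergyWindowCostateFloor
import HarnessLib

/-!
# Bond heat uncertainty — energy window: the A-PRIORI BOUND of a path costate in budget
  currency (rung (C1) beneath the open leaf (COF))

Cell `decomp-a2c`, lens-1 «grading / quantitative ladder», generation 84, crux
`stmt-AtomisticToContinuum-9121` (`ExtensiveSnapshotIrreversibility`, K_fix half, leaf S3), part M.
The open leaf (COF) `CostateObservabilityFloor` (part J) asks, for every path costate `c` on
`[0, s]` of the ANHARMONIC chain, `⟨c(s), c(s)⟩ ≤ K_θ · Θ_θ^μ · ∫₀ˢ β_0(r)² dr` with ONE exponent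
`μ` for all `θ > 0`.  Any proof starts from an a-priori control of the costate along the path; the
pathwise constant of part K (`costate_bounds`, a compactness `sup`) is useless for that, because a
`sup` of the energy over the window is not budget currency.  This file proves the a-priori bound IN
BUDGET CURRENCY, with an exponent `μ > 0` AS SMALL AS WE PLEASE — the «homogeneity upgrade» of
memo NODE-g84 §5, and the first grade of the anharmonic ladder beneath (COF):

* `norm_coDrift_apply_le` — the costate field grows at most like `√H`:
  `‖𝒢(x) c‖ ≤ (A₀ + A₁ √H(x)) ‖c‖` (the transpose of the tree's `norm_fderiv_drift_apply_le`,
  same constants `driftA₀`, `driftA₁`);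
* `exp_intervalIntegral_le` — Jensen for `exp` on the unit window, `exp(∫₀¹ g) ≤ ∫₀¹ exp g`;
* `exp_mul_integral_sqrt_pathEnergy_le` — **the budget dominates exponentials of sub-linear path
  functionals**: `exp(B ∫₀¹ √H(ζ_u) du) ≤ exp(B²/(4μθ)) · Θ_θ^μ` for every `θ, μ > 0`
  (pointwise `B√H ≤ μθ H + B²/(4μθ)`, then Jensen);
* `IsPathCostate.norm_le` — (C1) pathwise: `‖c(t)‖ ≤ ‖c(s)‖ exp(A₀ + A₁ ∫₀¹ √H(ζ_u) du)` on
  `[0, s]`, `s ≤ 1` (the tree's variable-coefficient Grönwall `norm_le_mul_exp_integral_of_eq_add_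
  integral` applied to the time-reversed costate; the integral equation comes from the
  right-derivative FTC, so the derivative is needed on `(0, s)` only — exactly `IsPathCostate`);
* `IsPathCostate.norm_le_budget` — (C1) in budget currency: for all `θ, μ > 0` there is
  `K = exp(A₀ + A₁²/(4μθ))` with `‖c(t)‖ ≤ K · Θ_θ^μ · ‖c(s)‖` for every path, window and costate.

So Grönwall losses — exponential in `∫ √H`, super-polynomial in the energy — are paid by an
arbitrarily small power of the budget: the quantifier order `∃ μ ∀ θ ∃ K` of (COF) survives the
a-priori step.  No measure theory beyond interval integrals of continuous functions is used.

References: tree `…EnergyWindowFlowJacobian` (`driftA₀`, `driftA₁`, `abs_hessPotential_le`,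
`norm_le_mul_exp_integral_of_eq_add_integral`), parts I-A (`energyBudget`), J (`IsPathCostate`).
-/

namespace Summit.AtomisticToContinuum.FouriersLaw.Theorems.ExtensiveSnapshotIrreversibility.EnergyWindow

open MeasureTheory Filter Topology Set
open scoped ENNReal NNReal
open Literature.MathematicalPhysics.KineticTheory.HeatConduction Literature.Probability.Process

/-! ## 1. The costate field grows at most like `√H` -/

section Field

variable {ω₂ lam β γ : ℝ} (hω : 0 < ω₂) (hl : 0 ≤ lam) (hβ : 0 ≤ β) (hγ : 0 ≤ γ) (N : ℕ)

include hω hl hβ hγ in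
/-- **The costate field grows at most like `√H`** (sup-norm on phase space):
`‖𝒢(x) c‖ ≤ (A₀ + A₁ √H(x)) ‖c‖`, with the constants of `norm_fderiv_drift_apply_le`. [folklore] -/
theorem norm_coDrift_apply_le (x c : PhaseSpace N) :
    ‖(pinnedChain ω₂ lam β γ).coDrift N x c‖ ≤
      (driftA₀ ω₂ γ N + driftA₁ lam β N * √((pinnedChain ω₂ lam β γ).hamiltonian N x)) * ‖c‖ := by
  set H := (pinnedChain ω₂ lam β γ).hamiltonian N x with hH
  set K := (ω₂ + (N : ℝ) * N) + (6 * √lam + (N : ℝ) * N * (6 * √β)) * √H with hK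
  have hKij : ∀ i j, |(pinnedChain ω₂ lam β γ).hessPotential N i j x.1| ≤ K :=
    fun i j => abs_hessPotential_le hω hl hβ N x i j
  have hK0 : 0 ≤ K := by rw [hK]; positivity
  have hA : driftA₀ ω₂ γ N + driftA₁ lam β N * √H = 1 + ((N : ℝ) * K + 2 * γ) := by
    rw [driftA₀, driftA₁, hK]; ring
  have hc1 : ∀ j, |c.1 j| ≤ ‖c‖ := fun j => by
    rw [← Real.norm_eq_abs]; exact (norm_le_pi_norm _ j).trans (norm_fst_le c)
  have hc2 : ∀ j, |c.2 j| ≤ ‖c‖ := fun j => by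
    rw [← Real.norm_eq_abs]; exact (norm_le_pi_norm _ j).trans (norm_snd_le c)
  have hNK : 0 ≤ (N : ℝ) * K * ‖c‖ := by positivity
  have hγc : 0 ≤ (1 + 2 * γ) * ‖c‖ := by positivity
  have hA0 : 0 ≤ (driftA₀ ω₂ γ N + driftA₁ lam β N * √H) * ‖c‖ := by
    rw [hA]; exact mul_nonneg (by positivity) (norm_nonneg _)
  rw [Prod.norm_def]
  refine max_le ((pi_norm_le_iff_of_nonneg hA0).2 fun j => ?_)
    ((pi_norm_le_iff_of_nonneg hA0).2 fun i => ?_)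
  · -- position block: `(𝒢 c).1 j = ∑_i c.2 i · Hess_{ij}`
    rw [Real.norm_eq_abs, OscillatorChain.coDrift_fst]
    calc |∑ i, c.2 i * (pinnedChain ω₂ lam β γ).hessPotential N i j x.1|
        ≤ ∑ i, |c.2 i * (pinnedChain ω₂ lam β γ).hessPotential N i j x.1| :=
          Finset.abs_sum_le_sum_abs _ _
      _ ≤ ∑ _i : Fin N, ‖c‖ * K := Finset.sum_le_sum fun i _ => by
          rw [abs_mul]; exact mul_le_mul (hc2 i) (hKij i j) (abs_nonneg _) (norm_nonneg _)
      _ = (N : ℝ) * K * ‖c‖ := by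
          simp only [Finset.sum_const, Finset.card_univ, Fintype.card_fin, nsmul_eq_mul]; ring
      _ ≤ (driftA₀ ω₂ γ N + driftA₁ lam β N * √H) * ‖c‖ := by rw [hA]; nlinarith [hγc]
  · -- momentum block: `(𝒢 c).2 i = -c.1 i + γ w_i c.2 i`
    rw [Real.norm_eq_abs, OscillatorChain.coDrift_snd]
    have hPγ : (pinnedChain ω₂ lam β γ).γ = γ := rfl
    have hb : |(pinnedChain ω₂ lam β γ).γ * OscillatorChain.bathWeight N i * c.2 i| ≤
        2 * γ * ‖c‖ := by
      rw [hPγ, abs_mul, abs_mul, abs_of_nonneg hγ, abs_of_nonneg (bathWeight_nonneg N i)]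
      exact mul_le_mul (((mul_le_mul_of_nonneg_left (bathWeight_le_two N i) hγ)).trans_eq
        (mul_comm _ _)) (hc2 i) (abs_nonneg _) (by positivity)
    calc |-c.1 i + (pinnedChain ω₂ lam β γ).γ * OscillatorChain.bathWeight N i * c.2 i|
        ≤ |-c.1 i| + |(pinnedChain ω₂ lam β γ).γ * OscillatorChain.bathWeight N i * c.2 i| :=
          abs_add_le _ _
      _ ≤ ‖c‖ + 2 * γ * ‖c‖ := by rw [abs_neg]; exact add_le_add (hc1 i) hb
      _ ≤ (driftA₀ ω₂ γ N + driftA₁ lam β N * √H) * ‖c‖ := by rw [hA]; nlinarith [hNK]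

end Field

/-! ## 2. Jensen for `exp` on the unit window, and the budget dominates `exp(B ∫ √H)` -/

/-- **Jensen for `exp`**: for continuous `g`, `exp(∫₀¹ g) ≤ ∫₀¹ exp(g)` (integrate the tangent
line of `exp` at the mean, `e^m (1 + (g - m)) ≤ e^g`). [folklore] -/
theorem exp_intervalIntegral_le {g : ℝ → ℝ} (hg : Continuous g) :
    Real.exp (∫ u in (0 : ℝ)..1, g u) ≤ ∫ u in (0 : ℝ)..1, Real.exp (g u) := by
  set m := ∫ u in (0 : ℝ)..1, g u with hm
  have htan : ∀ u, Real.exp m * (1 + (g u - m)) ≤ Real.exp (g u) := by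
    intro u
    have h1 := Real.add_one_le_exp (g u - m)
    have h2 : Real.exp (g u) = Real.exp m * Real.exp (g u - m) := by
      rw [← Real.exp_add]; congr 1; ring
    rw [h2]
    exact mul_le_mul_of_nonneg_left (by linarith) (Real.exp_pos m).le
  have hint : ∫ u in (0 : ℝ)..1, (1 + (g u - m)) = 1 := by
    have i1 : IntervalIntegrable (fun _ : ℝ => (1 : ℝ)) volume 0 1 := intervalIntegrable_const
    have i2 : IntervalIntegrable (fun u => g u - m) volume 0 1 :=
      (hg.sub continuous_const).intervalIntegrable _ _
    have i3 : IntervalIntegrable (fun u => g u) volume 0 1 := hg.intervalIntegrable _ _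
    have i4 : IntervalIntegrable (fun _ : ℝ => m) volume 0 1 := intervalIntegrable_const
    rw [intervalIntegral.integral_add i1 i2, intervalIntegral.integral_sub i3 i4,
      intervalIntegral.integral_const, intervalIntegral.integral_const, ← hm]
    simp
  calc Real.exp m = Real.exp m * ∫ u in (0 : ℝ)..1, (1 + (g u - m)) := by rw [hint, mul_one]
    _ = ∫ u in (0 : ℝ)..1, Real.exp m * (1 + (g u - m)) :=
        (intervalIntegral.integral_const_mul _ _).symm
    _ ≤ ∫ u in (0 : ℝ)..1, Real.exp (g u) :=
        intervalIntegral.integral_mono_on zero_le_one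
          ((continuous_const.mul (continuous_const.add (hg.sub continuous_const))).intervalIntegrable
            _ _) (hg.rexp.intervalIntegrable _ _) fun u _ => htan u

/-- AM–GM in the form used below: `B √H ≤ κ H + B²/(4κ)` (`H ≥ 0`, `κ > 0`, any real `B`).
[folklore] -/
theorem mul_sqrt_le_add {B κ H : ℝ} (hκ : 0 < κ) (hH : 0 ≤ H) :
    B * √H ≤ κ * H + B ^ 2 / (4 * κ) := by
  have hs : √H * √H = H := Real.mul_self_sqrt hH
  have hs2 : κ * κ * (√H * √H) = κ * κ * H := by rw [hs]
  have h4 : κ * H + B ^ 2 / (4 * κ) = (4 * κ * (κ * H) + B ^ 2) / (4 * κ) := by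
    field_simp
  rw [h4, le_div_iff₀ (by positivity)]
  nlinarith [sq_nonneg (2 * κ * √H - B), hs2, Real.sqrt_nonneg H]

section BudgetDomination

variable {ω₂ lam β γ : ℝ} (hω : 0 < ω₂) (hl : 0 ≤ lam) (hβ : 0 ≤ β) (hγ : 0 ≤ γ) {N : ℕ}
  {T_L T_R : ℝ}

include hω hl hβ hγ in
/-- **The budget dominates exponentials of sub-linear path functionals**: for `θ, μ > 0` and
real `B`, `exp(B ∫₀¹ √H(ζ_u) du) ≤ exp(B²/(4μθ)) · Θ_θ^μ` — an arbitrarily SMALL power of the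
budget pays for a Grönwall factor (pointwise AM–GM `B√H ≤ μθ H + B²/(4μθ)`, then Jensen
`exp(θ ∫₀¹ H) ≤ Θ_θ`). [NEW · the homogeneity upgrade of NODE-g84 §5] -/
theorem exp_mul_integral_sqrt_pathEnergy_le {θ μ : ℝ} (hθ : 0 < θ) (hμ : 0 < μ) (B : ℝ)
    (z : PhaseSpace N) (wp : WienerPair) :
    Real.exp (B * ∫ u in (0 : ℝ)..1, √(pathEnergy ω₂ lam β γ N T_L T_R z wp u)) ≤
      Real.exp (B ^ 2 / (4 * (μ * θ))) * energyBudget ω₂ lam β γ N T_L T_R θ z wp ^ μ := by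
  set Hp := pathEnergy ω₂ lam β γ N T_L T_R z wp with hHp
  have hHc : Continuous Hp := continuous_pathEnergy hω hl hβ hγ z wp
  have hH0 : ∀ u, 0 ≤ Hp u := pathEnergy_nonneg hω.le hl hβ z wp
  have hsc : Continuous fun u => √(Hp u) := hHc.sqrt
  -- pointwise AM–GM, integrated over the unit window
  have hpt : ∀ u, B * √(Hp u) ≤ μ * θ * Hp u + B ^ 2 / (4 * (μ * θ)) := fun u =>
    mul_sqrt_le_add (mul_pos hμ hθ) (hH0 u)
  have h1 : ∫ u in (0 : ℝ)..1, B * √(Hp u) ≤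
      ∫ u in (0 : ℝ)..1, (μ * θ * Hp u + B ^ 2 / (4 * (μ * θ))) :=
    intervalIntegral.integral_mono_on zero_le_one ((continuous_const.mul hsc).intervalIntegrable _ _)
      (((continuous_const.mul hHc).add continuous_const).intervalIntegrable _ _) fun u _ => hpt u
  have h2 : ∫ u in (0 : ℝ)..1, (μ * θ * Hp u + B ^ 2 / (4 * (μ * θ))) =
      μ * (θ * ∫ u in (0 : ℝ)..1, Hp u) + B ^ 2 / (4 * (μ * θ)) := by
    have i1 : IntervalIntegrable (fun u => μ * θ * Hp u) volume 0 1 :=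
      (continuous_const.mul hHc).intervalIntegrable _ _
    have i2 : IntervalIntegrable (fun _ : ℝ => B ^ 2 / (4 * (μ * θ))) volume 0 1 :=
      intervalIntegrable_const
    rw [intervalIntegral.integral_add i1 i2, intervalIntegral.integral_const_mul,
      intervalIntegral.integral_const, sub_zero, one_smul, mul_assoc]
  rw [intervalIntegral.integral_const_mul] at h1
  have hI : B * ∫ u in (0 : ℝ)..1, √(Hp u) ≤
      μ * (θ * ∫ u in (0 : ℝ)..1, Hp u) + B ^ 2 / (4 * (μ * θ)) := h1.trans_eq h2
  -- Jensen: `exp(θ ∫₀¹ H) ≤ Θ_θ`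
  have hJ : Real.exp (θ * ∫ u in (0 : ℝ)..1, Hp u) ≤ energyBudget ω₂ lam β γ N T_L T_R θ z wp := by
    rw [← intervalIntegral.integral_const_mul]
    exact exp_intervalIntegral_le (continuous_const.mul hHc)
  calc Real.exp (B * ∫ u in (0 : ℝ)..1, √(Hp u))
      ≤ Real.exp (μ * (θ * ∫ u in (0 : ℝ)..1, Hp u) + B ^ 2 / (4 * (μ * θ))) :=
        Real.exp_le_exp.2 hI
    _ = Real.exp (θ * ∫ u in (0 : ℝ)..1, Hp u) ^ μ * Real.exp (B ^ 2 / (4 * (μ * θ))) := by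
        rw [Real.exp_add, ← Real.exp_mul]
        congr 2
        ring
    _ ≤ energyBudget ω₂ lam β γ N T_L T_R θ z wp ^ μ * Real.exp (B ^ 2 / (4 * (μ * θ))) :=
        mul_le_mul_of_nonneg_right (Real.rpow_le_rpow (Real.exp_pos _).le hJ hμ.le)
          (Real.exp_pos _).le
    _ = Real.exp (B ^ 2 / (4 * (μ * θ))) * energyBudget ω₂ lam β γ N T_L T_R θ z wp ^ μ :=
        mul_comm _ _

end BudgetDomination

/-! ## 3. (C1): the a-priori bound of a path costate, pathwise and in budget currency -/

section Apriori

variable {ω₂ lam β γ : ℝ} (hω : 0 < ω₂) (hl : 0 ≤ lam) (hβ : 0 ≤ β) (hγ : 0 ≤ γ) (N : ℕ)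
  {T_L T_R : ℝ}

include hω hl hβ hγ in
/-- **(C1), pathwise.**  A path costate on `[0, s]`, `0 < s ≤ 1`, obeys
`‖c(t)‖ ≤ ‖c(s)‖ · exp(A₀ + A₁ ∫₀¹ √H(ζ_u) du)` for `t ∈ [0, s]`: variable-coefficient Grönwall
(tree `norm_le_mul_exp_integral_of_eq_add_integral`) for the time-reversed costate
`w(u) = c(s - u)`, whose integral equation `w(t) = w(0) - ∫₀ᵗ 𝒢(ζ_{s-u}) w(u) du` follows from
the right-derivative FTC with the derivative on `(0, s)` only. [NEW · rung (C1) beneath (COF)] -/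
theorem IsPathCostate.norm_le {s : ℝ} (hs0 : 0 < s) (hs1 : s ≤ 1) {z : PhaseSpace N}
    {wp : WienerPair} {c : ℝ → PhaseSpace N} (hc : IsPathCostate ω₂ lam β γ N T_L T_R s z wp c)
    {t : ℝ} (ht : t ∈ Icc 0 s) :
    ‖c t‖ ≤ ‖c s‖ * Real.exp (driftA₀ ω₂ γ N +
      driftA₁ lam β N * ∫ u in (0 : ℝ)..1, √(pathEnergy ω₂ lam β γ N T_L T_R z wp u)) := by
  set P := pinnedChain ω₂ lam β γ with hP
  set X : ℝ → PhaseSpace N := fun r => P.solMap N T_L T_R r z (pairPath wp) with hX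
  set Hp := pathEnergy ω₂ lam β γ N T_L T_R z wp with hHp
  have hHc : Continuous Hp := continuous_pathEnergy hω hl hβ hγ z wp
  -- the clamped, time-reversed costate `w(u) = c(s - u)` on `[0, s]`, continuous on `ℝ`
  set π : ℝ → ℝ := fun u => max 0 (min (s - u) s) with hπ
  have hπc : Continuous π :=
    continuous_const.max ((continuous_const.sub continuous_id).min continuous_const)
  have hπm : ∀ u, π u ∈ Icc 0 s := fun u => ⟨le_max_left _ _, max_le hs0.le (min_le_right _ _)⟩
  have hπe : ∀ u ∈ Icc 0 s, π u = s - u := fun u hu => by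
    simp only [hπ]
    rw [min_eq_left (by linarith [hu.1]), max_eq_right (by linarith [hu.2])]
  set w : ℝ → PhaseSpace N := fun u => c (π u) with hw
  have hwc : Continuous w := hc.1.comp_continuous hπc hπm
  have hw_eq : ∀ u ∈ Icc 0 s, w u = c (s - u) := fun u hu => by simp only [hw, hπe u hu]
  -- coefficient `A(u) = -𝒢(ζ_{s-u})` and rate `a(u) = A₀ + A₁ √H(ζ_{s-u})`
  set A : ℝ → PhaseSpace N →L[ℝ] PhaseSpace N :=
    fun u => -coDriftLinear ω₂ lam β γ N (X (s - u)) with hA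
  have hAc : Continuous A :=
    ((continuous_coDriftLinear_solMap hω hl hβ hγ N T_L T_R z wp).comp
      (continuous_const.sub continuous_id)).neg
  set a : ℝ → ℝ := fun u => driftA₀ ω₂ γ N + driftA₁ lam β N * √(Hp (s - u)) with ha
  have hsq : Continuous fun u => √(Hp (s - u)) := (hHc.comp (continuous_const.sub continuous_id)).sqrt
  have hac : Continuous a := continuous_const.add (continuous_const.mul hsq)
  have ha0 : ∀ u, 0 ≤ a u := fun u =>
    add_nonneg (driftA₀_nonneg hω.le hγ N) (mul_nonneg (driftA₁_nonneg lam β N) (Real.sqrt_nonneg _))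
  have hAa : ∀ u v, ‖A u v‖ ≤ a u * ‖v‖ := fun u v => by
    change ‖-(coDriftLinear ω₂ lam β γ N (X (s - u)) v)‖ ≤ _
    rw [norm_neg, coDriftLinear_apply]
    exact norm_coDrift_apply_le hω hl hβ hγ N (X (s - u)) v
  -- the derivative of `w` on `(0, s)`
  have hderiv : ∀ u ∈ Ioo 0 s, HasDerivAt w (A u (w u)) u := by
    intro u hu
    have hsu : s - u ∈ Ioo 0 s := ⟨by linarith [hu.2], by linarith [hu.1]⟩
    have h1 : HasDerivAt (fun v => c (s - v)) ((-1 : ℝ) • P.coDrift N (X (s - u)) (c (s - u))) u :=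
      (hc.2 (s - u) hsu).scomp u ((hasDerivAt_id u).const_sub s)
    have h2 : w =ᶠ[𝓝 u] fun v => c (s - v) := by
      filter_upwards [Ioo_mem_nhds hu.1 hu.2] with v hv
      exact hw_eq v (Ioo_subset_Icc_self hv)
    have h3 : A u (w u) = (-1 : ℝ) • P.coDrift N (X (s - u)) (c (s - u)) := by
      rw [hw_eq u (Ioo_subset_Icc_self hu), neg_one_smul]
      rfl
    rw [h3]
    exact h1.congr_of_eventuallyEq h2
  -- the integral equation on `[0, s]`
  have heq : ∀ t' ∈ Icc (0 : ℝ) s, w t' = w 0 + ∫ u in (0 : ℝ)..t', A u (w u) := by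
    intro t' ht'
    have hd : ∀ u ∈ Ioo 0 t', HasDerivWithinAt w (A u (w u)) (Ioi u) u := fun u hu =>
      (hderiv u ⟨hu.1, hu.2.trans_le ht'.2⟩).hasDerivWithinAt
    have hint : IntervalIntegrable (fun u => A u (w u)) volume 0 t' :=
      (hAc.clm_apply hwc).intervalIntegrable _ _
    rw [intervalIntegral.integral_eq_sub_of_hasDeriv_right_of_le ht'.1 hwc.continuousOn hd hint]
    abel
  -- Grönwall at `u = s - t`
  have hu : s - t ∈ Icc 0 s := ⟨by linarith [ht.2], by linarith [ht.1]⟩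
  have hgron := norm_le_mul_exp_integral_of_eq_add_integral (T := s) hwc hAc hac hAa ha0 heq hu
  have hst : s - (s - t) = t := by ring
  rw [hw_eq _ hu, hw_eq 0 ⟨le_rfl, hs0.le⟩, sub_zero, hst] at hgron
  -- the integrated rate is at most `A₀ + A₁ ∫₀¹ √H`
  have hI : ∫ u in (0 : ℝ)..(s - t), a u ≤
      driftA₀ ω₂ γ N + driftA₁ lam β N * ∫ u in (0 : ℝ)..1, √(Hp u) := by
    have i1 : IntervalIntegrable (fun _ => driftA₀ ω₂ γ N) volume 0 (s - t) :=
      intervalIntegrable_const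
    have i2 : IntervalIntegrable (fun u => driftA₁ lam β N * √(Hp (s - u))) volume 0 (s - t) :=
      (continuous_const.mul hsq).intervalIntegrable _ _
    have hsplit : ∫ u in (0 : ℝ)..(s - t), a u =
        (s - t - 0) • driftA₀ ω₂ γ N + driftA₁ lam β N * ∫ u in (0 : ℝ)..(s - t), √(Hp (s - u)) := by
      rw [← intervalIntegral.integral_const, ← intervalIntegral.integral_const_mul,
        ← intervalIntegral.integral_add i1 i2]
    have hsub : ∫ u in (0 : ℝ)..(s - t), √(Hp (s - u)) = ∫ v in t..s, √(Hp v) := by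
      rw [intervalIntegral.integral_comp_sub_left (fun v => √(Hp v)) s, hst, sub_zero]
    have hmono : ∫ v in t..s, √(Hp v) ≤ ∫ v in (0 : ℝ)..1, √(Hp v) :=
      intervalIntegral.integral_mono_interval ht.1 ht.2 hs1
        (Filter.Eventually.of_forall fun v => Real.sqrt_nonneg _) (hHc.sqrt.intervalIntegrable _ _)
    rw [hsplit, hsub, smul_eq_mul]
    have hA0 := driftA₀_nonneg hω.le hγ N
    have hA1 := driftA₁_nonneg lam β N
    have h1 : 0 ≤ (1 - (s - t - 0)) * driftA₀ ω₂ γ N := mul_nonneg (by linarith [ht.1]) hA0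
    have h2 : 0 ≤ driftA₁ lam β N *
        ((∫ v in (0 : ℝ)..1, √(Hp v)) - ∫ v in t..s, √(Hp v)) := mul_nonneg hA1 (sub_nonneg.2 hmono)
    nlinarith [h1, h2]
  exact hgron.trans (mul_le_mul_of_nonneg_left (Real.exp_le_exp.2 hI) (norm_nonneg _))

include hω hl hβ hγ in
/-- **(C1) in budget currency.**  For all `θ, μ > 0` there is `K = exp(A₀ + A₁²/(4μθ))` such that
every path costate on every window `[0, s]`, `0 < s ≤ 1`, along every driven path obeys
`‖c(t)‖ ≤ K · Θ_θ^μ · ‖c(s)‖` on `[0, s]`: the Grönwall loss costs an ARBITRARILY SMALL power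
of the budget, uniformly in the path, the temperatures and the window.
[NEW · rung (C1) beneath (COF), quantifier order `∀ θ ∀ μ ∃ K`] -/
theorem IsPathCostate.norm_le_budget {θ μ : ℝ} (hθ : 0 < θ) (hμ : 0 < μ) :
    ∃ K : ℝ, 0 < K ∧ ∀ (T_L T_R s : ℝ), 0 < s → s ≤ 1 →
      ∀ (z : PhaseSpace N) (wp : WienerPair) (c : ℝ → PhaseSpace N),
        IsPathCostate ω₂ lam β γ N T_L T_R s z wp c → ∀ t ∈ Icc 0 s,
          ‖c t‖ ≤ K * energyBudget ω₂ lam β γ N T_L T_R θ z wp ^ μ * ‖c s‖ := by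
  refine ⟨Real.exp (driftA₀ ω₂ γ N + driftA₁ lam β N ^ 2 / (4 * (μ * θ))), Real.exp_pos _,
    fun T_L T_R s hs0 hs1 z wp c hc t ht => ?_⟩
  have h1 := hc.norm_le hω hl hβ hγ N hs0 hs1 ht
  have h2 := exp_mul_integral_sqrt_pathEnergy_le (N := N) (T_L := T_L) (T_R := T_R) hω hl hβ hγ hθ
    hμ (driftA₁ lam β N) z wp
  have h3 : Real.exp (driftA₀ ω₂ γ N + driftA₁ lam β N *
      ∫ u in (0 : ℝ)..1, √(pathEnergy ω₂ lam β γ N T_L T_R z wp u)) ≤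
      Real.exp (driftA₀ ω₂ γ N + driftA₁ lam β N ^ 2 / (4 * (μ * θ))) *
        energyBudget ω₂ lam β γ N T_L T_R θ z wp ^ μ := by
    rw [Real.exp_add, Real.exp_add, mul_assoc]
    exact mul_le_mul_of_nonneg_left h2 (Real.exp_pos _).le
  calc ‖c t‖ ≤ ‖c s‖ * Real.exp (driftA₀ ω₂ γ N + driftA₁ lam β N *
        ∫ u in (0 : ℝ)..1, √(pathEnergy ω₂ lam β γ N T_L T_R z wp u)) := h1
    _ ≤ ‖c s‖ * (Real.exp (driftA₀ ω₂ γ N + driftA₁ lam β N ^ 2 / (4 * (μ * θ))) *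
        energyBudget ω₂ lam β γ N T_L T_R θ z wp ^ μ) :=
        mul_le_mul_of_nonneg_left h3 (norm_nonneg _)
    _ = Real.exp (driftA₀ ω₂ γ N + driftA₁ lam β N ^ 2 / (4 * (μ * θ))) *
        energyBudget ω₂ lam β γ N T_L T_R θ z wp ^ μ * ‖c s‖ := by ring

end Apriori

end Summit.AtomisticToContinuum.FouriersLaw.Theorems.ExtensiveSnapshotIrreversibility.EnergyWindow
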